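import Literature.NumberTheory.EllipticCurves.MazurTorsionLocalStepsProofs
import Literature.NumberTheory.EllipticCurves.DivisionPolynomialCuspJets
import Literature.NumberTheory.EllipticCurves.DivisionPolynomialMultiplication
import Literature.NumberTheory.EllipticCurves.FormalGroupDictionaryProofs
import Literature.NumberTheory.EllipticCurves.GlobalMinimalModelProofs
import Mathlib.AlgebraicGeometry.EllipticCurve.NormalForms
import HarnessLib

/-!
# Mazur 1977, Ch. III §5, Step 1 at `q = N`: no additive reduction at `N` (elementary proof)

Sibling proof file (theorems only) of `MazurTorsionLocalStepsProofs`, for the prime-case leaf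
`Literature.NumberTheory.EllipticCurves.Mazur1977_no_prime_torsion W` (B. Mazur, *Modular curves
and the Eisenstein ideal*, Publ. Math. IHÉS 47 (1977), Ch. III §5, pp. 156–160).

Step 1 of the printed proof (p. 158) is "`E_{/S}` is semi-stable". At a prime `q ≠ N` this is
the index argument of `MazurTorsionLocalStepsProofs` (`Mazur1977_stepOne`). At `q = N` Mazur
argues with Néron models: over an extension `𝒦/ℚ_N` of ramification index `e ≤ 6` the curve
acquires semistable reduction (Serre–Tate), the closure of `ℤ/N` in the Néron model over `𝒪_𝒦`
is a finite flat group scheme which, as `e ≤ 6 < N - 1`, is determined by its generic fibre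
(Raynaud), a contradiction. This file proves the same statement —

* `Mazur1977_stepOne_at_N`: an elliptic curve over `ℚ` with a rational point of prime order
  `N ≥ 11` does not have additive reduction at `N`,

hence (`Mazur1977_semistable`) **the putative curve of the leaf is semistable at every prime** —
by an elementary substitute for the Néron-model argument, in which the inequality `6 < N - 1`
reappears as "`840 = 2³·3·5·7` is an `N`-adic unit":

1. (`not_prime_zsmul_eq_zero_of_one_lt_norm`, *AEC* VII.3 / IV.6 for `K = ℚ_p`, `p` odd, by
   division polynomials) a point `(x, y)` of a `p`-integral equation over `ℚ_p` with `‖x‖ > 1`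
   is not killed by `p`: `ψ_p(x) = p·x^{(p²-1)/2} + (lower)` with `p`-integral lower coefficients
   and `‖x‖ ≥ p²`, so the leading term dominates.
2. (`not_prime_zsmul_eq_zero_of_norm_eq_one`) on a short equation `y² = x³ + ax + b` over `ℤ_p`
   with `a, b ∈ pℤ_p` (additive reduction) and `p ≥ 11`, a point with unit abscissa is not
   killed by `p`: by the first-order expansion of the division polynomials at the cusp
   (`DivisionPolynomialCuspJets.preΨ'_eval_sub_leading_mem`),
   `ψ_p(x) ≡ p·x^{(p²-1)/2} (mod p²)`.
3. a point reducing to the cusp lies outside `E₀`, so by Kodaira–Néron (`[E : E₀] ≤ 4`, tree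
   `hasSplitMultiplicativeReduction_of_not_mem_goodReductionSubgroup`) it is not killed by a
   prime `≥ 5` unless the reduction is split multiplicative.

## References

* [Mazur1977] B. Mazur, *Modular curves and the Eisenstein ideal*, Publ. Math. IHÉS 47 (1977),
  Ch. III §5, Step 1, p. 158.
* [SilvermanAEC2009] J. H. Silverman, *The Arithmetic of Elliptic Curves*, 2nd ed. (2009),
  IV.6.1, VII.3.1, VII.3.4; Exercise 3.7 (PDF pp. 97–98).
* [SilvermanATAEC1994] J. H. Silverman, *Advanced Topics*, IV.9 Cor. 9.2(d).

## Design

No definitions; `noncomputable section`, `open scoped Classical` as in the sibling files. The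
short model is Mathlib's `toShortNF` over `ℤ_p` (`2, 3 ∈ ℤ_pˣ` for `p ≥ 5`), kept minimal by the
tree's `IsMinimal.smul_baseChange`.
-/

noncomputable section

open scoped Classical

namespace Literature.NumberTheory.EllipticCurves

open _root_.WeierstrassCurve _root_.Polynomial

variable {p : ℕ} [Fact p.Prime]

/-! ## §1 A point with non-integral abscissa is not `p`-torsion (`p` odd, `K = ℚ_p`) -/

/-- If `‖y‖² = ‖x‖³` and `‖x‖ > 1` in `ℚ_p` then `‖x‖ ≥ p²` (norms are integral powers of `p`,
and `3·v(x) = 2·v(y)` forces `v(x)` even). [cite: SilvermanAEC2009, VII.3 Prop. 3.1 proof / IV.1] -/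
theorem sq_le_norm_of_norm_sq_eq_norm_cube {x y : ℚ_[p]} (hx : 1 < ‖x‖)
    (h : ‖y‖ ^ 2 = ‖x‖ ^ 3) : (p : ℝ) ^ 2 ≤ ‖x‖ := by
  have hp : 1 < (p : ℝ) := by exact_mod_cast (Fact.out : p.Prime).one_lt
  have hx0 : x ≠ 0 := by
    rintro rfl
    rw [norm_zero] at hx
    exact absurd hx (by norm_num)
  have hy0 : y ≠ 0 := by
    rintro rfl
    rw [norm_zero, zero_pow two_ne_zero] at h
    have : (0 : ℝ) < ‖x‖ ^ 3 := by positivity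
    linarith
  rw [Padic.norm_eq_zpow_neg_valuation hx0] at hx h ⊢
  rw [Padic.norm_eq_zpow_neg_valuation hy0, ← zpow_natCast, ← zpow_mul, ← zpow_natCast,
    ← zpow_mul] at h
  have hst : -y.valuation * (2 : ℕ) = -x.valuation * (3 : ℕ) :=
    zpow_right_injective₀ (by positivity) hp.ne' h
  have hs : 0 < -x.valuation := by
    by_contra hle
    push Not at hle
    have : (p : ℝ) ^ (-x.valuation) ≤ 1 := zpow_le_one_of_nonpos₀ hp.le hle
    linarith
  have hs2 : (2 : ℤ) ≤ -x.valuation := by push_cast at hst; omega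
  calc (p : ℝ) ^ 2 = (p : ℝ) ^ (2 : ℤ) := by norm_cast
    _ ≤ (p : ℝ) ^ (-x.valuation) := zpow_le_zpow_right₀ hp.le hs2

/-- **Leading-term domination**: a `p`-integral polynomial `Q` of degree `≤ d` with
`coeff_d Q = p`, evaluated at `x ∈ ℚ_p` with `‖x‖ ≥ p²` (`d ≥ 1`), does not vanish:
`‖p x^d‖ = p⁻¹‖x‖^d` exceeds `‖c_i x^i‖ ≤ ‖x‖^{d-1} ≤ p⁻²‖x‖^d` for `i < d`. [folklore] -/
theorem eval_map_ne_zero_of_coeff_eq_prime {Q : ℤ_[p][X]} {d : ℕ} (hd : 1 ≤ d)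
    (hdeg : Q.natDegree ≤ d) (hcoeff : Q.coeff d = p) {x : ℚ_[p]} (hx : (p : ℝ) ^ 2 ≤ ‖x‖) :
    (Q.map (algebraMap ℤ_[p] ℚ_[p])).eval x ≠ 0 := by
  have hp : 1 < (p : ℝ) := by exact_mod_cast (Fact.out : p.Prime).one_lt
  have hp0 : (0 : ℝ) < p := by positivity
  have hx1 : 1 ≤ ‖x‖ := le_trans (one_le_pow₀ hp.le) hx
  have hx0 : 0 < ‖x‖ := one_pos.trans_le hx1
  set Q' := Q.map (algebraMap ℤ_[p] ℚ_[p]) with hQ'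
  have hdeg' : Q'.natDegree < d + 1 :=
    (natDegree_map_le).trans_lt (Nat.lt_succ_of_le hdeg)
  rw [eval_eq_sum_range' hdeg', Finset.sum_range_succ]
  -- the top term
  have htop : Q'.coeff d * x ^ d = (p : ℚ_[p]) * x ^ d := by
    rw [hQ', coeff_map, hcoeff, map_natCast]
  have hntop : ‖(p : ℚ_[p]) * x ^ d‖ = (p : ℝ)⁻¹ * ‖x‖ ^ d := by
    rw [norm_mul, norm_pow, Padic.norm_p]
  -- the lower terms
  have hlow : ‖∑ i ∈ Finset.range d, Q'.coeff i * x ^ i‖ ≤ ((p : ℝ) ^ 2)⁻¹ * ‖x‖ ^ d := by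
    refine IsUltrametricDist.norm_sum_le_of_forall_le_of_nonneg (by positivity) fun i hi => ?_
    rw [Finset.mem_range] at hi
    have hc : ‖Q'.coeff i‖ ≤ 1 := by
      rw [hQ', coeff_map]
      exact PadicInt.norm_le_one _
    calc ‖Q'.coeff i * x ^ i‖ = ‖Q'.coeff i‖ * ‖x‖ ^ i := by rw [norm_mul, norm_pow]
      _ ≤ 1 * ‖x‖ ^ (d - 1) :=
          mul_le_mul hc (pow_le_pow_right₀ hx1 (by omega)) (by positivity) zero_le_one
      _ = ‖x‖ ^ d / ‖x‖ := by
          rw [one_mul, eq_div_iff hx0.ne', ← pow_succ, Nat.sub_add_cancel hd]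
      _ ≤ ‖x‖ ^ d / (p : ℝ) ^ 2 := by gcongr
      _ = ((p : ℝ) ^ 2)⁻¹ * ‖x‖ ^ d := by ring
  intro h0
  rw [htop, add_eq_zero_iff_eq_neg] at h0
  have h1 : ‖∑ i ∈ Finset.range d, Q'.coeff i * x ^ i‖ = (p : ℝ)⁻¹ * ‖x‖ ^ d := by
    rw [h0, norm_neg, hntop]
  rw [h1] at hlow
  have hxd : 0 < ‖x‖ ^ d := by positivity
  have : (p : ℝ)⁻¹ ≤ ((p : ℝ) ^ 2)⁻¹ := le_of_mul_le_mul_right hlow hxd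
  rw [inv_le_inv₀ hp0 (by positivity)] at this
  nlinarith

/-- A prime `p ≥ 3` is `2j + 3` for some `j`. [folklore] -/
theorem exists_eq_two_mul_add_three (hp3 : 3 ≤ p) : ∃ j : ℕ, p = 2 * j + 3 := by
  rcases (Fact.out : p.Prime).eq_two_or_odd' with h2 | ⟨k, hk⟩
  · omega
  · refine ⟨k - 1, ?_⟩
    omega

/-- **A point with non-integral abscissa on a `p`-integral equation over `ℚ_p` is not killed by
the odd prime `p`** (Silverman, *AEC*, VII.3.1 with IV.6.1 for `K = ℚ_p`, i.e. `E₁(ℚ_p)[p] = 0`,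
here by division polynomials: `p • P = O` would give `ψ_p(x) = 0`, while
`ψ_p = p·X^{(p²-1)/2} + (lower, p-integral)` and `‖x‖ ≥ p²`).
[cite: SilvermanAEC2009, VII.3 Prop. 3.1 and IV.6 Thm. 6.1 (statement); Exercise 3.7(b),(d),(f) (PDF pp. 97–98) (method)] -/
theorem not_prime_zsmul_eq_zero_of_one_lt_norm (hp3 : 3 ≤ p) (W₀ : WeierstrassCurve ℤ_[p])
    [(W₀.baseChange ℚ_[p]).IsElliptic] {x y : ℚ_[p]}
    (h : (W₀.baseChange ℚ_[p]).toAffine.Nonsingular x y) (hx : 1 < ‖x‖) :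
    (p : ℤ) • (Affine.Point.some x y h : (W₀.baseChange ℚ_[p]).toAffine.Point) ≠ 0 := by
  haveI : (W₀.baseChange ℚ_[p]).IsIntegral ℤ_[p] := ⟨⟨W₀, rfl⟩⟩
  obtain ⟨j, hj⟩ := exists_eq_two_mul_add_three hp3
  have hodd : ¬ Even p := by rw [hj, Nat.not_even_iff_odd]; exact ⟨j + 1, by ring⟩
  intro h0
  rw [zsmul_eq_zero_iff_evalEval_ψ_holds (W₀.baseChange ℚ_[p]) (p : ℤ) h] at h0
  have h1 := evalEval_ψ_sq (W₀.baseChange ℚ_[p]) h.1 (p : ℤ)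
  rw [h0, zero_pow two_ne_zero, ΨSq_ofNat, if_neg hodd, mul_one, eval_pow, eq_comm,
    pow_eq_zero_iff two_ne_zero] at h1
  -- `h1 : ((W₀ ⊗ ℚ_p).preΨ' p).eval x = 0`
  have h2 : (W₀.baseChange ℚ_[p]).preΨ' p = (W₀.preΨ' p).map (algebraMap ℤ_[p] ℚ_[p]) :=
    map_preΨ' W₀ (algebraMap ℤ_[p] ℚ_[p]) p
  rw [h2] at h1
  have hx2 := sq_le_norm_of_norm_sq_eq_norm_cube hx
    ((W₀.baseChange ℚ_[p]).norm_sq_eq_norm_cube h.1 hx).1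
  refine eval_map_ne_zero_of_coeff_eq_prime (d := (p ^ 2 - 1) / 2) ?_ ?_ ?_ hx2 h1
  · rw [hj]
    have : (2 * j + 3) ^ 2 - 1 = 2 * (2 * j ^ 2 + 6 * j + 4) := by
      rw [Nat.sub_eq_iff_eq_add (Nat.one_le_pow _ _ (by omega))]; ring
    rw [this, Nat.mul_div_cancel_left _ two_pos]
    omega
  · have := W₀.natDegree_preΨ'_le p
    rwa [if_neg hodd] at this
  · have := W₀.coeff_preΨ' p
    rwa [if_neg hodd, if_neg hodd] at this

/-! ## §2 A point with unit abscissa on an additive short fibre is not `p`-torsion (`p ≥ 11`) -/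

/-- `840 = 2³·3·5·7` is an `N`-adic unit for a prime `N ≥ 11`. [folklore] -/
theorem exists_mul_eq_one_840 (h11 : 11 ≤ p) : ∃ w : ℤ_[p], 840 * w = 1 := by
  have hP : p.Prime := Fact.out
  have hnorm : ‖((840 : ℤ) : ℤ_[p])‖ = 1 := by
    refine le_antisymm (PadicInt.norm_le_one _) (not_lt.mp fun hlt => ?_)
    rw [PadicInt.norm_int_lt_one_iff_dvd] at hlt
    have h840 : (840 : ℤ) = 2 ^ 3 * 3 * 5 * 7 := by norm_num
    rw [h840] at hlt
    have hp' : Prime (p : ℤ) := Nat.prime_iff_prime_int.mp hP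
    rcases hp'.dvd_or_dvd hlt with h | h
    · rcases hp'.dvd_or_dvd h with h | h
      · rcases hp'.dvd_or_dvd h with h | h
        · have := Int.le_of_dvd (by norm_num) (hp'.dvd_of_dvd_pow h); omega
        · have := Int.le_of_dvd (by norm_num) h; omega
      · have := Int.le_of_dvd (by norm_num) h; omega
    · have := Int.le_of_dvd (by norm_num) h; omega
  obtain ⟨u, hu⟩ := PadicInt.isUnit_iff.mpr hnorm
  refine ⟨↑u⁻¹, ?_⟩
  rw [show (840 : ℤ_[p]) = ((840 : ℤ) : ℤ_[p]) by norm_cast, ← hu, Units.mul_inv]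

/-- An element of `ℤ_p` of norm `< 1` is a multiple of `p`. [folklore] -/
theorem exists_eq_p_mul_of_norm_lt_one {a : ℤ_[p]} (ha : ‖a‖ < 1) : ∃ a' : ℤ_[p], a = p * a' := by
  obtain ⟨a', ha'⟩ := (PadicInt.norm_lt_one_iff_dvd a).mp ha
  exact ⟨a', ha'⟩

/-- **On `y² = x³ + ax + b` over `ℤ_p` with `a, b ∈ pℤ_p` and `p ≥ 11`, a point with unit
abscissa is not killed by `p`.** If `p • P = O` then `ψ_p(x) = 0`; but by the first-order
expansion of the division polynomials at the cusp
(`CuspJets.preΨ'_eval_sub_leading_mem`, both first-order coefficients carrying the factor `p`,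
`840 ∈ ℤ_pˣ`), `ψ_p(x) ≡ p·x^{(p²-1)/2} (mod p²)`, which is non-zero for a unit `x`. This is the
elementary replacement of Mazur's Néron-model argument at `q = N` (Raynaud's `e ≤ 6 < N - 1`).
[cite: Mazur1977, Ch. III §5, Step 1, p. 158; SilvermanAEC2009, Exercise 3.7(d),(f) (PDF pp. 97–98)] -/
theorem not_prime_zsmul_eq_zero_of_norm_eq_one (h11 : 11 ≤ p) {A B : ℤ_[p]} (hA : ‖A‖ < 1)
    (hB : ‖B‖ < 1) [((CuspJets.shortCurve A B).baseChange ℚ_[p]).IsElliptic] {x₀ y₀ : ℤ_[p]}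
    (hx : ‖x₀‖ = 1)
    (h : ((CuspJets.shortCurve A B).baseChange ℚ_[p]).toAffine.Nonsingular
      (algebraMap ℤ_[p] ℚ_[p] x₀) (algebraMap ℤ_[p] ℚ_[p] y₀)) :
    (p : ℤ) • (Affine.Point.some _ _ h :
      ((CuspJets.shortCurve A B).baseChange ℚ_[p]).toAffine.Point) ≠ 0 := by
  obtain ⟨j, hj⟩ := exists_eq_two_mul_add_three (p := p) (by omega)
  have hodd : ¬ Even p := by rw [hj, Nat.not_even_iff_odd]; exact ⟨j + 1, by ring⟩
  obtain ⟨w, hw⟩ := exists_mul_eq_one_840 (p := p) h11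
  intro h0
  rw [zsmul_eq_zero_iff_evalEval_ψ_holds ((CuspJets.shortCurve A B).baseChange ℚ_[p]) (p : ℤ) h]
    at h0
  have h1 := evalEval_ψ_sq ((CuspJets.shortCurve A B).baseChange ℚ_[p]) h.1 (p : ℤ)
  rw [h0, zero_pow two_ne_zero, ΨSq_ofNat, if_neg hodd, mul_one, eval_pow, eq_comm,
    pow_eq_zero_iff two_ne_zero, show ((CuspJets.shortCurve A B).baseChange ℚ_[p]).preΨ' p =
      ((CuspJets.shortCurve A B).preΨ' p).map (algebraMap ℤ_[p] ℚ_[p]) from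
        map_preΨ' (CuspJets.shortCurve A B) (algebraMap ℤ_[p] ℚ_[p]) p,
    eval_map, eval₂_at_apply, map_eq_zero_iff _ (IsFractionRing.injective ℤ_[p] ℚ_[p])] at h1
  -- `h1 : ψ_p(x₀) = 0` in `ℤ_p`; the cusp expansion modulo `p²`
  have key := CuspJets.preΨ'_eval_sub_leading_mem x₀ A B hw j
  rw [← hj] at key
  have hcast : (2 * (j : ℤ_[p]) + 3) = (p : ℤ_[p]) := by
    have e := congrArg (Nat.cast : ℕ → ℤ_[p]) hj
    push_cast at e
    exact e.symm
  rw [hcast, h1, zero_sub, neg_mem_iff] at key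
  -- the ideal `(pA, pB) + (A, B)²` is contained in `(p²)`
  obtain ⟨A', rfl⟩ := exists_eq_p_mul_of_norm_lt_one hA
  obtain ⟨B', rfl⟩ := exists_eq_p_mul_of_norm_lt_one hB
  have hI : Ideal.span {(p : ℤ_[p]) * A', (p : ℤ_[p]) * B'} ≤ Ideal.span {(p : ℤ_[p])} := by
    rw [Ideal.span_le]
    rintro z (rfl | rfl)
    · exact Ideal.mem_span_singleton.mpr (dvd_mul_right _ _)
    · exact Ideal.mem_span_singleton.mpr (dvd_mul_right _ _)
  have hle : Ideal.span {(p : ℤ_[p]) * ((p : ℤ_[p]) * A'), (p : ℤ_[p]) * ((p : ℤ_[p]) * B')} ⊔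
      CuspJets.cuspIdealSq ((p : ℤ_[p]) * A') ((p : ℤ_[p]) * B') ≤
        Ideal.span {(p : ℤ_[p]) ^ 2} := by
    refine sup_le ?_ ?_
    · rw [Ideal.span_le]
      rintro z (rfl | rfl)
      · exact Ideal.mem_span_singleton.mpr ⟨A', by ring⟩
      · exact Ideal.mem_span_singleton.mpr ⟨B', by ring⟩
    · rw [CuspJets.cuspIdealSq, ← Ideal.span_singleton_pow]
      exact Ideal.pow_right_mono hI 2
  have hmem := hle key
  rw [Ideal.mem_span_singleton] at hmem
  obtain ⟨t, ht⟩ := hmem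
  have hp0 : (p : ℤ_[p]) ≠ 0 := by exact_mod_cast (Fact.out : p.Prime).ne_zero
  have ht' : x₀ ^ (2 * j ^ 2 + 6 * j + 4) = (p : ℤ_[p]) * t := by
    apply mul_left_cancel₀ hp0
    rw [ht]; ring
  have hn : ‖x₀ ^ (2 * j ^ 2 + 6 * j + 4)‖ < 1 := by
    rw [ht', norm_mul]
    refine mul_lt_one_of_nonneg_of_lt_one_left (norm_nonneg _) ?_ (PadicInt.norm_le_one _)
    rw [PadicInt.norm_p]
    exact inv_lt_one_of_one_lt₀ (by exact_mod_cast (Fact.out : p.Prime).one_lt)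
  rw [norm_pow, hx, one_pow] at hn
  exact lt_irrefl _ hn

/-! ## §3 Additive reduction at `p ≥ 11` and a point killed by `p` -/

/-- Positive integers below `p` are `p`-adic units. [folklore] -/
theorem norm_natCast_eq_one_of_lt {n : ℕ} (hn0 : n ≠ 0) (hnp : n < p) : ‖(n : ℤ_[p])‖ = 1 := by
  refine le_antisymm (PadicInt.norm_le_one _) (not_lt.mp fun hlt => ?_)
  have h : ‖((n : ℤ) : ℤ_[p])‖ < 1 := by exact_mod_cast hlt
  rw [PadicInt.norm_int_lt_one_iff_dvd] at h
  have h' : p ∣ n := by exact_mod_cast h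
  exact absurd (Nat.le_of_dvd (Nat.pos_of_ne_zero hn0) h') (not_le.mpr hnp)

/-- `‖2‖ = ‖3‖ = 1` in `ℤ_p` for `p ≥ 5`, hence `‖48‖ = ‖16‖ = ‖27‖ = 1`. [folklore] -/
theorem norm_two_three (hp5 : 5 ≤ p) : ‖(2 : ℤ_[p])‖ = 1 ∧ ‖(3 : ℤ_[p])‖ = 1 :=
  ⟨by exact_mod_cast norm_natCast_eq_one_of_lt (p := p) (n := 2) two_ne_zero (by omega),
   by exact_mod_cast norm_natCast_eq_one_of_lt (p := p) (n := 3) three_ne_zero (by omega)⟩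

/-- `c₄` and `Δ` of `y² = x³ + ax + b`. [folklore] -/
theorem shortCurve_c₄_Δ (A B : ℤ_[p]) :
    (CuspJets.shortCurve A B).c₄ = -48 * A ∧
      (CuspJets.shortCurve A B).Δ = -16 * (4 * A ^ 3 + 27 * B ^ 2) := by
  constructor
  · simp only [WeierstrassCurve.c₄, WeierstrassCurve.b₂, WeierstrassCurve.b₄]
    ring
  · simp only [WeierstrassCurve.Δ, WeierstrassCurve.b₂, WeierstrassCurve.b₄, WeierstrassCurve.b₆,
      WeierstrassCurve.b₈]
    ring

/-- **The short model of an additive fibre**: if `y² = x³ + ax + b` over `ℤ_p` (`p ≥ 5`) has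
`c₄ = -48a ∈ pℤ_p` and `Δ = -16(4a³ + 27b²) ∈ pℤ_p` then `a, b ∈ pℤ_p`. [folklore] -/
theorem norm_lt_one_of_short {A B : ℤ_[p]} (hp5 : 5 ≤ p)
    (hc₄ : ‖(CuspJets.shortCurve A B).c₄‖ < 1) (hΔ : ‖(CuspJets.shortCurve A B).Δ‖ < 1) :
    ‖A‖ < 1 ∧ ‖B‖ < 1 := by
  obtain ⟨h2, h3⟩ := norm_two_three (p := p) hp5
  obtain ⟨e4, eΔ⟩ := shortCurve_c₄_Δ A B
  rw [e4, show (-48 : ℤ_[p]) * A = -(2 ^ 4 * 3 * A) by ring, norm_neg, norm_mul, norm_mul,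
    norm_pow, h2, h3, one_pow, one_mul, one_mul] at hc₄
  refine ⟨hc₄, ?_⟩
  rw [eΔ, show (-16 : ℤ_[p]) * (4 * A ^ 3 + 27 * B ^ 2) = -(2 ^ 4 * (4 * A ^ 3 + 27 * B ^ 2))
    by ring, norm_neg, norm_mul, norm_pow, h2, one_pow, one_mul] at hΔ
  have hA3 : ‖4 * A ^ 3‖ < 1 := by
    rw [show (4 : ℤ_[p]) * A ^ 3 = 2 ^ 2 * A ^ 3 by norm_num, norm_mul, norm_pow, norm_pow, h2,
      one_pow, one_mul]
    exact pow_lt_one₀ (norm_nonneg _) hc₄ three_ne_zero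
  have hB2 : ‖27 * B ^ 2‖ < 1 := by
    calc ‖27 * B ^ 2‖ = ‖(4 * A ^ 3 + 27 * B ^ 2) + -(4 * A ^ 3)‖ := by ring_nf
      _ ≤ max ‖4 * A ^ 3 + 27 * B ^ 2‖ ‖-(4 * A ^ 3)‖ := PadicInt.nonarchimedean _ _
      _ < 1 := by rw [norm_neg]; exact max_lt hΔ hA3
  rw [show (27 : ℤ_[p]) * B ^ 2 = 3 ^ 3 * B ^ 2 by norm_num, norm_mul, norm_pow, norm_pow, h3,
    one_pow, one_mul] at hB2
  by_contra hB
  rw [le_antisymm (PadicInt.norm_le_one _) (not_lt.mp hB), one_pow] at hB2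
  exact lt_irrefl _ hB2

/-- The ordinate of an integral point is integral (`p`-integral equation). [folklore] -/
theorem norm_y_le_one' (W₀ : WeierstrassCurve ℤ_[p]) {x y : ℚ_[p]}
    (heq : (W₀.baseChange ℚ_[p]).toAffine.Equation x y) (hx : ‖x‖ ≤ 1) : ‖y‖ ≤ 1 := by
  by_contra hy
  push Not at hy
  replace heq : y ^ 2 + algebraMap ℤ_[p] ℚ_[p] W₀.a₁ * x * y + algebraMap ℤ_[p] ℚ_[p] W₀.a₃ * y =
      x ^ 3 + algebraMap ℤ_[p] ℚ_[p] W₀.a₂ * x ^ 2 + algebraMap ℤ_[p] ℚ_[p] W₀.a₄ * x +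
        algebraMap ℤ_[p] ℚ_[p] W₀.a₆ := (Affine.equation_iff _ _).mp heq
  have hn : ∀ z : ℤ_[p], ‖algebraMap ℤ_[p] ℚ_[p] z‖ = ‖z‖ := fun z => rfl
  have h₁ := PadicInt.norm_le_one W₀.a₁
  have h₂ := PadicInt.norm_le_one W₀.a₂
  have h₃ := PadicInt.norm_le_one W₀.a₃
  have h₄ := PadicInt.norm_le_one W₀.a₄
  have h₆ := PadicInt.norm_le_one W₀.a₆
  have hy0 : 0 < ‖y‖ := one_pos.trans hy
  -- right-hand side has norm `≤ 1`
  have hR : ‖x ^ 3 + algebraMap ℤ_[p] ℚ_[p] W₀.a₂ * x ^ 2 + algebraMap ℤ_[p] ℚ_[p] W₀.a₄ * x +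
      algebraMap ℤ_[p] ℚ_[p] W₀.a₆‖ ≤ 1 := by
    refine (Padic.nonarchimedean _ _).trans (max_le ((Padic.nonarchimedean _ _).trans
      (max_le ((Padic.nonarchimedean _ _).trans (max_le ?_ ?_)) ?_)) ?_)
    · rw [norm_pow]; exact pow_le_one₀ (norm_nonneg _) hx
    · rw [norm_mul, norm_pow, hn]
      exact mul_le_one₀ h₂ (by positivity) (pow_le_one₀ (norm_nonneg _) hx)
    · rw [norm_mul, hn]
      exact mul_le_one₀ h₄ (norm_nonneg _) hx
    · rw [hn]; exact h₆
  -- left-hand side has norm `‖y‖² > 1`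
  have hl : ‖algebraMap ℤ_[p] ℚ_[p] W₀.a₁ * x * y + algebraMap ℤ_[p] ℚ_[p] W₀.a₃ * y‖ < ‖y ^ 2‖ := by
    rw [norm_pow, sq]
    refine (Padic.nonarchimedean _ _).trans_lt (max_lt ?_ ?_)
    · rw [norm_mul, norm_mul, hn]
      calc ‖W₀.a₁‖ * ‖x‖ * ‖y‖ ≤ 1 * 1 * ‖y‖ := by gcongr
        _ < ‖y‖ * ‖y‖ := by rw [one_mul, one_mul]; exact lt_mul_left hy0 hy
    · rw [norm_mul, hn]
      calc ‖W₀.a₃‖ * ‖y‖ ≤ 1 * ‖y‖ := by gcongr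
        _ < ‖y‖ * ‖y‖ := by rw [one_mul]; exact lt_mul_left hy0 hy
  have hL : ‖y ^ 2 + algebraMap ℤ_[p] ℚ_[p] W₀.a₁ * x * y + algebraMap ℤ_[p] ℚ_[p] W₀.a₃ * y‖ =
      ‖y‖ ^ 2 := by
    rw [add_assoc, Padic.add_eq_max_of_ne (hl.ne'), max_eq_left hl.le, norm_pow]
  rw [heq] at hL
  have : (1 : ℝ) < ‖y‖ ^ 2 := one_lt_pow₀ hy two_ne_zero
  linarith

/-- **The core case**: on a minimal short equation `y² = x³ + ax + b` over `ℚ_p` with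
`a, b ∈ pℤ_p` and `p ≥ 11`, no point other than `O` is killed by `p`. Trichotomy on `x(P)`:
non-integral (`not_prime_zsmul_eq_zero_of_one_lt_norm`), unit
(`not_prime_zsmul_eq_zero_of_norm_eq_one`), or in `pℤ_p`, in which case `P` reduces to the
cusp `(0, 0)` and lies outside `E₀`, so that `p • P = O` would make the reduction split
multiplicative by Kodaira–Néron (`hasSplitMultiplicativeReduction_of_not_mem_goodReductionSubgroup`),
whereas `c₄ = -48a ∈ pℤ_p`.
[cite: Mazur1977, Ch. III §5, Step 1, p. 158; SilvermanATAEC1994, Cor. IV.9.2(d) (PDF p. 340)] -/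
theorem not_prime_zsmul_eq_zero_of_short (h11 : 11 ≤ p) {A B : ℤ_[p]} (hA : ‖A‖ < 1)
    (hB : ‖B‖ < 1) (V : WeierstrassCurve ℚ_[p])
    (hV : V = (CuspJets.shortCurve A B).baseChange ℚ_[p]) [V.IsElliptic] [V.IsMinimal ℤ_[p]]
    {P : V.toAffine.Point} (hP0 : P ≠ 0) : (p : ℤ) • P ≠ 0 := by
  subst hV
  have hP' : p.Prime := Fact.out
  rcases P with _ | ⟨x, y, h⟩
  · exact absurd rfl hP0
  by_cases hx : 1 < ‖x‖
  · exact not_prime_zsmul_eq_zero_of_one_lt_norm (by omega) (CuspJets.shortCurve A B) h hx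
  push Not at hx
  have hy : ‖y‖ ≤ 1 := norm_y_le_one' (CuspJets.shortCurve A B) h.1 hx
  obtain ⟨x₀, rfl⟩ : ∃ x₀ : ℤ_[p], algebraMap ℤ_[p] ℚ_[p] x₀ = x := ⟨⟨x, hx⟩, rfl⟩
  obtain ⟨y₀, rfl⟩ : ∃ y₀ : ℤ_[p], algebraMap ℤ_[p] ℚ_[p] y₀ = y := ⟨⟨y, hy⟩, rfl⟩
  by_cases hx1 : ‖x₀‖ = 1
  · exact not_prime_zsmul_eq_zero_of_norm_eq_one h11 hA hB hx1 h
  have hx0 : ‖x₀‖ < 1 := lt_of_le_of_ne (PadicInt.norm_le_one _) hx1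
  -- the equation in `ℤ_p`: `y₀² = x₀³ + A x₀ + B`, so `y₀ ∈ pℤ_p` as well
  have heq : y₀ ^ 2 = x₀ ^ 3 + A * x₀ + B := by
    have h1 : algebraMap ℤ_[p] ℚ_[p] y₀ ^ 2 +
        algebraMap ℤ_[p] ℚ_[p] 0 * algebraMap ℤ_[p] ℚ_[p] x₀ * algebraMap ℤ_[p] ℚ_[p] y₀ +
        algebraMap ℤ_[p] ℚ_[p] 0 * algebraMap ℤ_[p] ℚ_[p] y₀ =
        algebraMap ℤ_[p] ℚ_[p] x₀ ^ 3 + algebraMap ℤ_[p] ℚ_[p] 0 * algebraMap ℤ_[p] ℚ_[p] x₀ ^ 2 +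
        algebraMap ℤ_[p] ℚ_[p] A * algebraMap ℤ_[p] ℚ_[p] x₀ + algebraMap ℤ_[p] ℚ_[p] B :=
      (Affine.equation_iff _ _).mp h.1
    apply IsFractionRing.injective ℤ_[p] ℚ_[p]
    simp only [map_pow, map_add, map_mul]
    simp only [map_zero, zero_mul, add_zero] at h1
    exact h1
  have hy0 : ‖y₀‖ < 1 := by
    have h1 : ‖y₀ ^ 2‖ < 1 := by
      rw [heq]
      refine (PadicInt.nonarchimedean _ _).trans_lt (max_lt ((PadicInt.nonarchimedean _ _).trans_lt
        (max_lt ?_ ?_)) hB)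
      · rw [norm_pow]; exact pow_lt_one₀ (norm_nonneg _) hx0 three_ne_zero
      · rw [norm_mul]; exact mul_lt_one_of_nonneg_of_lt_one_left (norm_nonneg _) hA
          (PadicInt.norm_le_one _)
    rw [norm_pow] at h1
    by_contra hy1
    rw [le_antisymm (PadicInt.norm_le_one _) (not_lt.mp hy1), one_pow] at h1
    exact lt_irrefl _ h1
  intro hkill
  -- `P ∉ E₀`: it reduces to the cusp `(0, 0)` of `ȳ² = x̄³`
  have hv := integers_valuationRing_valuation ℤ_[p] ℚ_[p]
  have hnotin : (Affine.Point.some _ _ h : ((CuspJets.shortCurve A B).baseChange ℚ_[p]).toAffine.Point) ∉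
      ((CuspJets.shortCurve A B).baseChange ℚ_[p]).goodReductionSubgroup ℤ_[p] := by
    rw [goodReductionSubgroup_baseChange_eq, mem_nonsingularReductionSubgroup_iff,
      hasNonsingularReduction_some_algebraMap_iff hv.hom_inj,
      (IsLocalRing.residue_eq_zero_iff _).mpr (PadicInt.mem_nonunits.mpr hx0),
      (IsLocalRing.residue_eq_zero_iff _).mpr (PadicInt.mem_nonunits.mpr hy0),
      Affine.nonsingular_zero]
    rintro ⟨-, h3 | h4⟩
    · exact h3 (map_zero (IsLocalRing.residue ℤ_[p]))
    · exact h4 ((IsLocalRing.residue_eq_zero_iff A).mpr (PadicInt.mem_nonunits.mpr hA))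
  haveI : Finite (IsLocalRing.ResidueField ℤ_[p]) :=
    Finite.of_equiv (ZMod p) (PadicInt.residueField (p := p)).symm.toEquiv
  haveI : PerfectField (IsLocalRing.ResidueField ℤ_[p]) := PerfectField.ofFinite
  obtain ⟨hsplit, -⟩ := hasSplitMultiplicativeReduction_of_not_mem_goodReductionSubgroup ℤ_[p]
    ((CuspJets.shortCurve A B).baseChange ℚ_[p]) hP' (by omega)
    (P := Affine.Point.some _ _ h) (by rw [← natCast_zsmul]; exact hkill) hnotin
  have hmult := hsplit.toHasMultiplicativeReduction.multiplicativeReduction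
  have ec : ((CuspJets.shortCurve A B).baseChange ℚ_[p]).c₄ =
      algebraMap ℤ_[p] ℚ_[p] (CuspJets.shortCurve A B).c₄ :=
    map_c₄ (CuspJets.shortCurve A B) (algebraMap ℤ_[p] ℚ_[p])
  rw [ec, (shortCurve_c₄_Δ A B).1,
    IsDedekindDomain.HeightOneSpectrum.valuation_eq_one_iff_notMem] at hmult
  refine hmult (PadicInt.mem_nonunits.mpr ?_)
  rw [show (-48 : ℤ_[p]) * A = -(48 * A) by ring, norm_neg, norm_mul]
  exact mul_lt_one_of_nonneg_of_lt_one_right (PadicInt.norm_le_one _) (norm_nonneg _) hA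

/-- `toShortNF` has `u = 1`. [folklore] -/
theorem toShortNF_u {R : Type*} [CommRing R] [Invertible (2 : R)] [Invertible (3 : R)]
    (W : WeierstrassCurve R) : W.toShortNF.u = 1 := by
  rw [WeierstrassCurve.toShortNF, VariableChange.mul_def]
  simp [WeierstrassCurve.toCharNeTwoNF]

/-- **Mazur 1977, Ch. III §5, Step 1 at `q = N`, local form**: over `ℚ_p`, `p ≥ 11`, an elliptic
curve whose minimal model has **additive** reduction has no `ℚ_p`-point `P ≠ O` with
`p • P = O`. The minimal integral model is brought to short form `y² = x³ + ax + b` over `ℤ_p`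
by Mathlib's `toShortNF` (`2, 3 ∈ ℤ_pˣ`, `u = 1`, so the model stays minimal with the same
`c₄`, `Δ`); additive reduction gives `a, b ∈ pℤ_p` (`norm_lt_one_of_short`), and
`not_prime_zsmul_eq_zero_of_short` applies to the transported point.
[cite: Mazur1977, Ch. III §5, Step 1, p. 158] -/
theorem not_prime_zsmul_eq_zero_of_hasAdditiveReduction (h11 : 11 ≤ p)
    (W : WeierstrassCurve ℚ_[p]) [W.IsElliptic] [hadd : W.HasAdditiveReduction ℤ_[p]]
    {P : W.toAffine.Point} (hP0 : P ≠ 0) : (p : ℤ) • P ≠ 0 := by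
  obtain ⟨h2, h3⟩ := norm_two_three (p := p) (by omega)
  haveI : Invertible (2 : ℤ_[p]) := (PadicInt.isUnit_iff.mpr h2).invertible
  haveI : Invertible (3 : ℤ_[p]) := (PadicInt.isUnit_iff.mpr h3).invertible
  have hc₄ := hadd.additiveReduction
  have hΔ := hadd.badReduction
  obtain ⟨W₀, hW₀⟩ : ∃ W₀ : WeierstrassCurve ℤ_[p], W = W₀.baseChange ℚ_[p] :=
    IsIntegral.integral
  subst hW₀
  set D : VariableChange ℤ_[p] := W₀.toShortNF with hD
  have hDu : D.u = 1 := toShortNF_u W₀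
  haveI hNF : (D • W₀).IsShortNF := WeierstrassCurve.toShortNF_spec W₀
  set A := (D • W₀).a₄ with hA'
  set B := (D • W₀).a₆ with hB'
  have hM : D • W₀ = CuspJets.shortCurve A B :=
    WeierstrassCurve.ext hNF.a₁ hNF.a₂ hNF.a₃ rfl rfl
  -- the short model is additive: `c₄, Δ ∈ pℤ_p`
  have hc₄' : ‖(CuspJets.shortCurve A B).c₄‖ < 1 := by
    rw [← hM, variableChange_c₄, hDu, inv_one, Units.val_one, one_pow, one_mul]
    have ec : (W₀.baseChange ℚ_[p]).c₄ = algebraMap ℤ_[p] ℚ_[p] W₀.c₄ :=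
      map_c₄ W₀ (algebraMap ℤ_[p] ℚ_[p])
    rw [ec, IsDedekindDomain.HeightOneSpectrum.valuation_lt_one_iff_mem] at hc₄
    exact PadicInt.mem_nonunits.mp hc₄
  have hΔ' : ‖(CuspJets.shortCurve A B).Δ‖ < 1 := by
    rw [← hM, variableChange_Δ, hDu, inv_one, Units.val_one, one_pow, one_mul]
    have eΔ : (W₀.baseChange ℚ_[p]).Δ = algebraMap ℤ_[p] ℚ_[p] W₀.Δ :=
      map_Δ W₀ (algebraMap ℤ_[p] ℚ_[p])
    rw [eΔ, IsDedekindDomain.HeightOneSpectrum.valuation_lt_one_iff_mem] at hΔ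
    exact PadicInt.mem_nonunits.mp hΔ
  obtain ⟨hA, hB⟩ := norm_lt_one_of_short (p := p) (by omega) hc₄' hΔ'
  -- the short model over `ℚ_p` and the transported point
  have hV : D.baseChange ℚ_[p] • W₀.baseChange ℚ_[p] =
      (CuspJets.shortCurve A B).baseChange ℚ_[p] := by
    rw [← hM]
    exact map_variableChange W₀ D (algebraMap ℤ_[p] ℚ_[p])
  haveI : (D.baseChange ℚ_[p] • W₀.baseChange ℚ_[p]).IsMinimal ℤ_[p] :=
    IsMinimal.smul_baseChange (W₀.baseChange ℚ_[p]) D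
  set e := VariableChange.pointEquiv (W₀.baseChange ℚ_[p]) (D.baseChange ℚ_[p])
  have hP1 : e P ≠ 0 := fun h0 => hP0 (e.injective (h0.trans e.map_zero.symm))
  intro hkill
  refine not_prime_zsmul_eq_zero_of_short h11 hA hB _ hV hP1 ?_
  rw [← map_zsmul e, hkill, map_zero]

/-! ## §4 Over `ℚ`: Step 1 at `q = N` and semistability of the putative curve -/

section Rat

variable (W : WeierstrassCurve ℚ) [W.IsElliptic] (N : ℕ) [Fact N.Prime]

/-- **Mazur 1977, Ch. III §5, Step 1 at the prime `q = N`** (p. 158; there by Serre–Tate and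
Raynaud's theorem on finite flat group schemes of order `N` over a base of ramification
`e ≤ 6 < N - 1`; here by `not_prime_zsmul_eq_zero_of_hasAdditiveReduction`): an elliptic curve
over `ℚ` with a rational point of prime order `N ≥ 11` does not have additive reduction at `N`.
[cite: Mazur1977, Ch. III §5, Step 1, p. 158] -/
theorem Mazur1977_stepOne_at_N (h11 : 11 ≤ N) {P : W.toAffine.Point} (hP : addOrderOf P = N) :
    ¬ ((W.baseChange ℚ_[N]).minimal ℤ_[N]).HasAdditiveReduction ℤ_[N] := by
  intro hadd
  haveI := hadd
  haveI : (W.baseChange ℚ_[N]).IsElliptic := inferInstanceAs (W.map (algebraMap ℚ ℚ_[N])).IsElliptic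
  have hmin : (W.baseChange ℚ_[N]).minimal ℤ_[N] =
      ((W.baseChange ℚ_[N]).exists_isMinimal ℤ_[N]).choose • W.baseChange ℚ_[N] := rfl
  haveI : ((W.baseChange ℚ_[N]).minimal ℤ_[N]).IsElliptic := by
    rw [hmin]
    infer_instance
  set P' : ((W.baseChange ℚ_[N]).minimal ℤ_[N]).toAffine.Point :=
    VariableChange.pointEquiv (W.baseChange ℚ_[N])
      ((W.baseChange ℚ_[N]).exists_isMinimal ℤ_[N]).choose
      (Affine.Point.map (W' := W.toAffine) (S := ℚ) (Algebra.ofId ℚ ℚ_[N]) P) with hP'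
  have hP'ord : addOrderOf P' = N :=
    ((AddEquiv.addOrderOf_eq _ _).trans (addOrderOf_injective _
      (Affine.Point.map_injective (W' := W.toAffine) (f := Algebra.ofId ℚ ℚ_[N])) P)).trans hP
  have hP'0 : P' ≠ 0 := by
    intro h0
    rw [h0, addOrderOf_zero] at hP'ord
    exact absurd hP'ord.symm (by omega)
  have hkill : (N : ℤ) • P' = 0 := by
    have e := addOrderOf_nsmul_eq_zero P'
    rw [hP'ord] at e
    rw [natCast_zsmul]
    exact e
  exact not_prime_zsmul_eq_zero_of_hasAdditiveReduction h11 _ hP'0 hkill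

omit [Fact N.Prime] in
/-- **The putative curve of the leaf is semistable** (Mazur 1977, Ch. III §5, Step 1 in full:
"`E_{/S}` is semi-stable. That is, `E` has semi-stable (i.e. good or multiplicative) reduction
at all points of `S`"): an elliptic curve over `ℚ` with a rational point of prime order
`N ∉ {2, 3, 5, 7, 13}` does not have additive reduction at any prime `q` — at `q ≠ N` by the
index argument (`Mazur1977_stepOne`), at `q = N` by `Mazur1977_stepOne_at_N`.
[cite: Mazur1977, Ch. III §5, Step 1, p. 158] -/
theorem Mazur1977_semistable {N : ℕ} (hN : N.Prime) (hNS : N ∉ ({2, 3, 5, 7, 13} : Finset ℕ))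
    {P : W.toAffine.Point} (hP : addOrderOf P = N) (q : ℕ) [Fact q.Prime] :
    ¬ ((W.baseChange ℚ_[q]).minimal ℤ_[q]).HasAdditiveReduction ℤ_[q] := by
  have h11 := eleven_le_of_prime_of_not_mem hN hNS
  by_cases hqN : q = N
  · subst hqN
    exact Mazur1977_stepOne_at_N W q h11 hP
  · exact Mazur1977_stepOne W q hN hNS hP hqN

/-- Equivalently: at every prime the reduction of the putative curve is good or multiplicative.
[cite: Mazur1977, Ch. III §5, Step 1, p. 158] -/
theorem Mazur1977_good_or_multiplicative {N : ℕ} (hN : N.Prime)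
    (hNS : N ∉ ({2, 3, 5, 7, 13} : Finset ℕ)) {P : W.toAffine.Point} (hP : addOrderOf P = N)
    (q : ℕ) [Fact q.Prime] :
    W.HasGoodReductionAtPrime q ∨ W.HasMultiplicativeReductionAtPrime q := by
  rcases hasGoodReduction_or_hasMultiplicativeReduction_or_hasAdditiveReduction ℤ_[q]
      (W := (W.baseChange ℚ_[q]).minimal ℤ_[q]) with hg | hm | ha
  · exact Or.inl hg
  · exact Or.inr hm
  · exact absurd ha (Mazur1977_semistable W hN hNS hP q)

end Rat

end Literature.NumberTheory.EllipticCurves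

end
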